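import Mathlib
import Summits.Ventures.PercRepro2.K5TypedK3Marks
import Summits.Ventures.PercRepro2.TwoMarkHubGlue

/-!
# The gluing theorem on `K₅` itself (blind cell PercRepro2, mine-2 g40, 2026-08-28;
`proofs/MINE2-HUBK5.md` §3, row M2-85 — part I of the certificate from `K₅`)

`K₅` itself is a hub (`isHub_K5`: the slots are its seven edges at the confined pair, the rest
its three boundary edges).  The gluing theorem applied to `K₅` with the slots typed `t` and the
boundary edges `a₁x`, `a₂x` typed `n_L`, `n_H` (`six_mul_typedCount_K5`) expresses six times that
typed count as the `plc` sum over the placements of the two boundary edges of the gadget sum at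
the pattern triple they realise (`pp`: `x ~ a₁` in the copies of the first, `x ~ a₂` in those of
the second, both joined in a copy where they meet); the evaluation of that sum — every
placement realises an arrangement of the same multiset or is killed by `Q` — and the certificate
`C_nonneg` are in `TwoMarkHubCert.lean`.  Own code; standard axioms.
-/

namespace Summit.Ventures.PercRepro2

open UnionCluster

namespace CovForm

namespace THub

open OneTyped Untouched OStar K5 TypedFactor SepThree TypedRed

/-! ## `K₅` is a hub -/

section K5Hub

/-- The slots of `K₅`: its own slot edges. -/
def slot5 (h : HubType) : Fin 7 → Option (Fin 10) := fun i => some (h.slotE i)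

/-- The marks of `K₅` are the identity. -/
lemma mark5_eq (i : Fin 5) : mark (0 : Fin 5) 1 2 3 4 i = i := by
  fin_cases i <;> rfl

/-- The marks of `K₅` are the identity map. -/
lemma mark5_eq_id : mark (0 : Fin 5) 1 2 3 4 = id := funext mark5_eq

/-- **`K₅` is a hub** for every hub type. -/
lemma isHub_K5 (h : HubType) : IsHub ends5 0 1 2 3 4 h (slot5 h) where
  hslot := by
    intro i e hi
    simp only [slot5, Option.some.injEq] at hi
    subst hi
    rw [mark5_eq_id, Sym2.map_id]
    rfl
  all := by
    intro e he
    rw [mark5_eq, mark5_eq] at he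
    obtain ⟨i, hi⟩ := h.exists_slot_of_mem e he
    exact ⟨i, by rw [slot5, hi]⟩
  inj := by
    rw [mark5_eq_id]
    exact Function.injective_id

/-- The two boundary edges `a₁x`, `a₂x` are distinct. -/
lemma bdE_zero_ne_one (h : HubType) : h.bdE 0 ≠ h.bdE 1 := by
  cases h <;> decide

end K5Hub

/-! ## The typed instance on `K₅` realising a typing and a boundary multiset -/

section Instance

variable {R : Type*} [Field R]

/-- The typed slots: the slot edges of nonzero type. -/
def FA (h : HubType) (t : Fin 7 → ℕ) : Finset (Fin 10) :=
  (Finset.univ.filter fun i : Fin 7 => t i ≠ 0).image h.slotE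

/-- The typed boundary edges: `a₁x` when `n_L ≠ 0`, `a₂x` when `n_H ≠ 0`. -/
def FB (h : HubType) (nL nH : ℕ) : Finset (Fin 10) :=
  (if nL ≠ 0 then {h.bdE 0} else ∅) ∪ (if nH ≠ 0 then {h.bdE 1} else ∅)

/-- The typed set of the instance. -/
def F5 (h : HubType) (t : Fin 7 → ℕ) (nL nH : ℕ) : Finset (Fin 10) := FA h t ∪ FB h nL nH

/-- The type map of the instance: `n_L`, `n_H` on the boundary edges, `t` on the slots. -/
def τ5 (h : HubType) (t : Fin 7 → ℕ) (nL nH : ℕ) : Fin 10 → ℕ := fun e =>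
  if e = h.bdE 0 then nL else if e = h.bdE 1 then nH else
    ∑ j : Fin 7, if e = h.slotE j then t j else 0

/-- The pattern realised by the two boundary edges' values: `x ~ a₁` by the first, `x ~ a₂` by the
second, the roots joined when both are open. -/
def pp : Bool → Bool → Pat3
  | false, false => (false, false, false)
  | true, false => (true, false, false)
  | false, true => (false, true, false)
  | true, true => (true, true, true)

/-- A slot edge is typed `t`. -/
lemma τ5_slotE (h : HubType) (t : Fin 7 → ℕ) (nL nH : ℕ) (i : Fin 7) :
    τ5 h t nL nH (h.slotE i) = t i := by
  simp only [τ5, if_neg (h.bdE_ne_slotE 0 i).symm, if_neg (h.bdE_ne_slotE 1 i).symm]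
  rw [Finset.sum_eq_single i]
  · simp
  · intro j _ hj
    rw [if_neg]
    intro hij
    exact hj (h.slotE_injective hij).symm
  · intro hi; exact absurd (Finset.mem_univ i) hi

/-- Membership in the typed slots. -/
lemma mem_FA {h : HubType} {t : Fin 7 → ℕ} {i : Fin 7} : h.slotE i ∈ FA h t ↔ t i ≠ 0 := by
  simp only [FA, Finset.mem_image, Finset.mem_filter, Finset.mem_univ, true_and]
  constructor
  · rintro ⟨j, hj, hji⟩
    rw [h.slotE_injective hji] at hj
    exact hj
  · intro hi; exact ⟨i, hi, rfl⟩

/-- A boundary edge is not a typed slot. -/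
lemma bdE_not_mem_FA (h : HubType) (t : Fin 7 → ℕ) (m : Fin 3) : h.bdE m ∉ FA h t := by
  simp only [FA, Finset.mem_image, Finset.mem_filter, Finset.mem_univ, true_and, not_exists,
    not_and]
  intro i _ hi
  exact h.bdE_ne_slotE m i hi.symm

/-- A slot edge is not a typed boundary edge. -/
lemma slotE_not_mem_FB (h : HubType) (nL nH : ℕ) (i : Fin 7) : h.slotE i ∉ FB h nL nH := by
  simp only [FB, Finset.mem_union, not_or]
  constructor
  · split_ifs
    · simp only [Finset.mem_singleton]; exact (h.bdE_ne_slotE 0 i).symm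
    · exact Finset.notMem_empty _
  · split_ifs
    · simp only [Finset.mem_singleton]; exact (h.bdE_ne_slotE 1 i).symm
    · exact Finset.notMem_empty _

/-- The typed boundary edges are among the two boundary edges. -/
lemma mem_FB {h : HubType} {nL nH : ℕ} {e : Fin 10} (he : e ∈ FB h nL nH) :
    e = h.bdE 0 ∨ e = h.bdE 1 := by
  simp only [FB, Finset.mem_union] at he
  rcases he with he | he <;> split_ifs at he <;>
    simp only [Finset.mem_singleton, Finset.notMem_empty] at he
  · exact Or.inl he
  · exact Or.inr he

/-- The hub side of the instance is the typed slots. -/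
lemma sideA_F5 (h : HubType) (t : Fin 7 → ℕ) (nL nH : ℕ) :
    sideA ends5 0 1 2 3 4 h (F5 h t nL nH) = FA h t := by
  ext e
  rw [mem_sideA, mark5_eq, mark5_eq]
  constructor
  · rintro ⟨he, hc⟩
    rcases Finset.mem_union.1 he with he | he
    · exact he
    · exfalso
      rcases mem_FB he with rfl | rfl
      · rcases hc with hc | hc
        · exact (h.confined_not_mem_bd 0).1 hc
        · exact (h.confined_not_mem_bd 0).2 hc
      · rcases hc with hc | hc
        · exact (h.confined_not_mem_bd 1).1 hc
        · exact (h.confined_not_mem_bd 1).2 hc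
  · intro he
    refine ⟨Finset.mem_union_left _ he, ?_⟩
    simp only [FA, Finset.mem_image] at he
    obtain ⟨i, _, rfl⟩ := he
    exact h.confined_mem_slot i

/-- The rest side of the instance is the typed boundary edges. -/
lemma sideB_F5 (h : HubType) (t : Fin 7 → ℕ) (nL nH : ℕ) :
    sideB ends5 0 1 2 3 4 h (F5 h t nL nH) = FB h nL nH := by
  ext e
  rw [mem_sideB, mark5_eq, mark5_eq]
  constructor
  · rintro ⟨he, hc⟩
    rcases Finset.mem_union.1 he with he | he
    · exfalso
      simp only [FA, Finset.mem_image] at he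
      obtain ⟨i, _, rfl⟩ := he
      exact hc (h.confined_mem_slot i)
    · exact he
  · intro he
    refine ⟨Finset.mem_union_right _ he, ?_⟩
    rcases mem_FB he with rfl | rfl
    · rintro (hc | hc)
      · exact (h.confined_not_mem_bd 0).1 hc
      · exact (h.confined_not_mem_bd 0).2 hc
    · rintro (hc | hc)
      · exact (h.confined_not_mem_bd 1).1 hc
      · exact (h.confined_not_mem_bd 1).2 hc

/-- The typing read off the instance is `t`. -/
lemma typOf_F5 (h : HubType) (t : Fin 7 → ℕ) (nL nH : ℕ) :
    typOf (slot5 h) (FA h t) (fun _ => false) (τ5 h t nL nH) = t := by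
  funext i
  simp only [typOf, slot5, typ]
  by_cases hi : t i = 0
  · rw [if_neg (fun h' => (mem_FA.1 h') hi), if_neg Bool.false_ne_true, hi]
  · rw [if_pos (mem_FA.2 hi), τ5_slotE]

/-- The first boundary edge is typed iff `n_L ≠ 0`. -/
lemma mem_FB_zero (h : HubType) (nL nH : ℕ) : h.bdE 0 ∈ FB h nL nH ↔ nL ≠ 0 := by
  unfold FB
  by_cases hL : nL = 0 <;> by_cases hH : nH = 0 <;>
    simp [hL, hH, bdE_zero_ne_one h]

/-- The second boundary edge is typed iff `n_H ≠ 0`. -/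
lemma mem_FB_one (h : HubType) (nL nH : ℕ) : h.bdE 1 ∈ FB h nL nH ↔ nH ≠ 0 := by
  unfold FB
  by_cases hL : nL = 0 <;> by_cases hH : nH = 0 <;>
    simp [hL, hH, (bdE_zero_ne_one h).symm]

/-- The type of the first boundary edge in the rest side is `n_L`. -/
lemma typ_bd0 (h : HubType) (t : Fin 7 → ℕ) (nL nH : ℕ) :
    typ (some (h.bdE 0)) (FB h nL nH) (fun _ => false) (τ5 h t nL nH) = nL := by
  simp only [typ]
  by_cases hL : nL = 0
  · rw [if_neg (fun hmem => (mem_FB_zero h nL nH).1 hmem hL), if_neg Bool.false_ne_true, hL]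
  · rw [if_pos ((mem_FB_zero h nL nH).2 hL)]
    simp only [τ5, if_true]

/-- The type of the second boundary edge in the rest side is `n_H`. -/
lemma typ_bd1 (h : HubType) (t : Fin 7 → ℕ) (nL nH : ℕ) :
    typ (some (h.bdE 1)) (FB h nL nH) (fun _ => false) (τ5 h t nL nH) = nH := by
  simp only [typ]
  by_cases hH : nH = 0
  · rw [if_neg (fun hmem => (mem_FB_one h nL nH).1 hmem hH), if_neg Bool.false_ne_true, hH]
  · rw [if_pos ((mem_FB_one h nL nH).2 hH)]
    simp only [τ5, if_neg (bdE_zero_ne_one h).symm, if_true]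

/-- After the two boundary edges are erased nothing of the rest side is left. -/
lemma eraseO_FB (h : HubType) (nL nH : ℕ) :
    eraseO (some (h.bdE 1)) (eraseO (some (h.bdE 0)) (FB h nL nH)) = ∅ := by
  ext e
  simp only [eraseO, Finset.mem_erase, ne_eq, Finset.notMem_empty, iff_false, not_and]
  intro h1 h0 he
  rcases mem_FB he with rfl | rfl
  · exact h0 rfl
  · exact h1 rfl

/-- The configuration with the two boundary edges' values and everything else closed. -/
def cfgB (h : HubType) (c₀ c₁ : Bool) : Config (Fin 10) :=
  fun e => if e = h.bdE 0 then c₀ else if e = h.bdE 1 then c₁ else false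

/-- On the rest side's support a configuration is `cfgB` of its boundary values. -/
lemma eq_cfgB {h : HubType} {nL nH : ℕ} {x : Config (Fin 10)}
    (hx : ∀ e, e ∉ FB h nL nH → x e = false) : x = cfgB h (x (h.bdE 0)) (x (h.bdE 1)) := by
  funext e
  simp only [cfgB]
  split_ifs with h0 h1
  · rw [h0]
  · rw [h1]
  · apply hx
    intro he
    rcases mem_FB he with he | he
    · exact h0 he
    · exact h1 he

/-- **The pattern of `cfgB`** is the pattern realised by the two values. -/
lemma pat_cfgB (h : HubType) (c₀ c₁ : Bool) :
    pat ends5 0 1 2 3 4 h (cfgB h c₀ c₁) = pp c₀ c₁ := by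
  cases h <;> cases c₀ <;> cases c₁ <;> (simp only [pat, decide_conn5, pp]; decide)

/-- On the rest side's support the pattern is the pattern realised by the boundary values. -/
lemma pat_support {h : HubType} {nL nH : ℕ} {x : Config (Fin 10)}
    (hx : ∀ e, e ∉ FB h nL nH → x e = false) :
    pat ends5 0 1 2 3 4 h x = pp (x (h.bdE 0)) (x (h.bdE 1)) := by
  have hc := eq_cfgB hx
  conv_lhs => rw [hc]
  exact pat_cfgB h _ _

/-- **The gluing theorem on `K₅`**: six times the typed count of the instance is the `plc` sum over
the placements of the two boundary edges of the gadget sum at the realised pattern triple. -/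
theorem six_mul_typedCount_K5 (h : HubType) (t : Fin 7 → ℕ) (nL nH : ℕ) :
    6 * typedCount (F5 h t nL nH) (fun _ => false) (τ5 h t nL nH)
        (K3 ends5 0 1 2 3 4 : Config (Fin 10) → Config (Fin 10) → Config (Fin 10) → R) =
      ((plc nL).map fun c₀ => ((plc nH).map fun c₁ =>
        ((C h t (pp c₀.1 c₁.1) (pp c₀.2.1 c₁.2.1) (pp c₀.2.2 c₁.2.2) : ℤ) : R)).sum).sum := by
  rw [six_mul_typedCount_eq (isHub_K5 h) (F5 h t nL nH) (fun _ => false) (τ5 h t nL nH),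
    sideA_F5, sideB_F5, typOf_F5, ← typedCount_eq_sum_cond]
  have hsupp := typedCount_congr_on_support (FB h nL nH) (fun _ => false) (τ5 h t nL nH)
    (K := fun xb yb wb => ((C h t (pat ends5 0 1 2 3 4 h xb) (pat ends5 0 1 2 3 4 h yb)
      (pat ends5 0 1 2 3 4 h wb) : ℤ) : R))
    (K' := fun xb yb wb => ((C h t (pp (val (some (h.bdE 0)) xb) (val (some (h.bdE 1)) xb))
      (pp (val (some (h.bdE 0)) yb) (val (some (h.bdE 1)) yb))
      (pp (val (some (h.bdE 0)) wb) (val (some (h.bdE 1)) wb)) : ℤ) : R))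
    (fun xb yb wb hc _ => by
      simp only [val]
      rw [pat_support (fun e he => (hc e he).1), pat_support (fun e he => (hc e he).2.1),
        pat_support (fun e he => (hc e he).2.2)])
  rw [hsupp]
  have hne : ∀ e e', some (h.bdE 0) = some e → some (h.bdE 1) = some e' → e ≠ e' := by
    intro e e' he he'
    simp only [Option.some.injEq] at he he'
    rw [← he, ← he']
    exact bdE_zero_ne_one h
  rw [peel (some (h.bdE 0)) (FB h nL nH) (fun _ => false) (τ5 h t nL nH)
    (fun v₁ v₂ v₃ x y w => ((C h t (pp v₁ (val (some (h.bdE 1)) x))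
      (pp v₂ (val (some (h.bdE 1)) y)) (pp v₃ (val (some (h.bdE 1)) w)) : ℤ) : R)), typ_bd0]
  refine congrArg List.sum (List.map_congr_left fun c₀ _ => ?_)
  simp only [val_updO hne]
  rw [peel (some (h.bdE 1)) (eraseO (some (h.bdE 0)) (FB h nL nH))
    (updO (some (h.bdE 0)) (fun _ => false) false) (τ5 h t nL nH)
    (fun v₁ v₂ v₃ _ _ _ => ((C h t (pp c₀.1 v₁) (pp c₀.2.1 v₂) (pp c₀.2.2 v₃) : ℤ) : R)),
    typ_eraseO_updO hne, typ_bd1]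
  refine congrArg List.sum (List.map_congr_left fun c₁ _ => ?_)
  rw [eraseO_FB]
  exact typedCount_empty _ _ _

end Instance

end THub

end CovForm

end Summit.Ventures.PercRepro2
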